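import Literature.MathematicalPhysics.QuantumLattice.HubbardModelParticleHoleProofs
import HarnessLib

/-!
# The partial particle–hole transformation on a set of orbitals

Topic `Literature/MathematicalPhysics/QuantumLattice` (family `hubbard`), companion to the FULL
particle–hole transformation `particleHole` of `FermionOperators.lean` (which exchanges particles
and holes on EVERY orbital). Here, for a finite set of orbitals `D ⊆ ι` of the Jordan–Wigner Fock
space `Fock ι = Finset ι → ℂ` (`HubbardWave0`), we define the unitary

* `partialParticleHole D`, `W |s⟩ = (∏_{j ∈ s} σ_j(D)) |s ∆ D⟩`, `σ_j(D) = jwSign j D = (-1)^{#{l ∈ D | l < j}}`,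

and prove that it is unitary (`partialParticleHole_mul_conjTranspose`,
`partialParticleHole_conjTranspose_mul`) and implements the particle–hole exchange on `D` ONLY,
WITHOUT residual signs:

* `W c_i Wᴴ = c_i` for `i ∉ D` (`partialParticleHole_conj_annihilation_of_not_mem`),
* `W c_i Wᴴ = c†_i` for `i ∈ D` (`partialParticleHole_conj_annihilation_of_mem`),

and the adjoint statements for `c†_i`. With `ι = Orb Λ` and `D` the set of down-spin orbitals this
is Lieb's transformation `c_{x↓} ↦ c†_{x↓}` (Lieb 1989, proof of Theorem 2: "make a hole–particle
transformation on the down-spins only"), which maps the repulsive to the attractive Hubbard model and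
a BCS pair source `c_{x↑}c_{y↓}` to a spin-flip hopping `c_{x↑}c†_{y↓}`, i.e. a particle-number
CONSERVING quadratic term — the device by which Bach–Lieb–Solovej reduce BCS (quasi-free with pairing)
states of the Hubbard model to ordinary one-particle density matrices (Bach–Lieb–Solovej 1994, §2,
the particle–hole transformation `𝒲` and Theorem 2.3). The weights `∏_{j∈s} σ_j(D)` are exactly what
is needed to absorb the Jordan–Wigner strings: no sign function survives in the conjugation formulas,
for an arbitrary linear order on `ι` and an arbitrary `D`.

All statements are finite-dimensional algebra and fully proved (no `sorry`, no named facts).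

## Mathlib / tree search

Mathlib: `symmDiff` on `Finset` (`Finset.mem_symmDiff`, `symmDiff_symmDiff_cancel_right`), no CAR
algebra. Tree (`lean search 'particleHole|jwSign_'`): `particleHole` (full transformation, all
orbitals, prescribed phases) and its discharges in `HubbardModelParticleHoleProofs`
(`annihilation_mulVec_apply`, `creation_mulVec_apply`, `matrix_eq_of_mulVec_eq`, `jwSign_mul_self`,
`jwSign_erase_self`); nothing for a PARTIAL (subset) transformation.

## References

* E. H. Lieb, *Two theorems on the Hubbard model*, Phys. Rev. Lett. 62 (1989) 1201–1204, proof of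
  Theorem 2 (hole–particle transformation on one spin species). [Lieb1989]
* V. Bach, E. H. Lieb, J. P. Solovej, *Generalized Hartree–Fock theory and the Hubbard model*,
  J. Stat. Phys. 76 (1994) 3–89, §2 (particle–hole transformations and quasi-free states with
  pairing). [BachLiebSolovej1994]
* H. Tasaki, *Physics and Mathematics of Quantum Many-Body Systems* (2020), §9.3.3. [Tasaki2020]
-/

noncomputable section

namespace Literature.MathematicalPhysics.QuantumLattice

open Matrix Finset HubbardWave0
open scoped symmDiff

variable {ι : Type*} [LinearOrder ι]

/-! ### Jordan–Wigner signs and symmetric differences -/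

/-- The weight `w_D(s) = ∏_{j ∈ s} jwSign j D` of the partial particle–hole transformation.
[cite: BachLiebSolovej1994, §2] -/
def phWeight (D s : Finset ι) : ℂ := ∏ j ∈ s, jwSign j D

/-- `w_D(s)² = 1`. [folklore] -/
theorem phWeight_mul_self (D s : Finset ι) : phWeight D s * phWeight D s = 1 := by
  rw [phWeight, ← Finset.prod_mul_distrib]
  exact Finset.prod_eq_one fun j _ => jwSign_mul_self j D

/-- `w_D(s)` is real: `star w_D(s) = w_D(s)`. [folklore] -/
@[simp] theorem star_phWeight (D s : Finset ι) : star (phWeight D s) = phWeight D s := by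
  rw [phWeight, star_prod]
  exact Finset.prod_congr rfl fun j _ => star_jwSign j D

/-- `w_D(insert i s) = jwSign i D · w_D(s)` for `i ∉ s`. [folklore] -/
theorem phWeight_insert {i : ι} {s : Finset ι} (D : Finset ι) (hi : i ∉ s) :
    phWeight D (insert i s) = jwSign i D * phWeight D s := by
  rw [phWeight, Finset.prod_insert hi, phWeight]

/-- The Jordan–Wigner sign is multiplicative over symmetric differences:
`jwSign i (s ∆ D) = jwSign i s · jwSign i D` (the counts below `i` add up modulo `2`). [folklore] -/
theorem jwSign_symmDiff (i : ι) (s D : Finset ι) :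
    jwSign i (s ∆ D) = jwSign i s * jwSign i D := by
  classical
  have hfilter : (s ∆ D).filter (· < i) = (s.filter (· < i)) ∆ (D.filter (· < i)) := by
    ext x
    simp only [Finset.mem_filter, Finset.mem_symmDiff]
    tauto
  have hcard : ∀ A B : Finset ι, (A ∆ B).card + 2 * (A ∩ B).card = A.card + B.card := by
    intro A B
    have h1 : A ∆ B = (A \ B) ∪ (B \ A) := rfl
    have hdisj : Disjoint (A \ B) (B \ A) := by
      rw [Finset.disjoint_left]
      intro x hx hx'
      exact (Finset.mem_sdiff.1 hx').2 (Finset.mem_sdiff.1 hx).1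
    rw [h1, Finset.card_union_of_disjoint hdisj]
    have hA := Finset.card_sdiff_add_card_inter A B
    have hB := Finset.card_sdiff_add_card_inter B A
    rw [Finset.inter_comm B A] at hB
    omega
  rw [jwSign, jwSign, jwSign, hfilter, ← pow_add]
  set A := s.filter (· < i)
  set B := D.filter (· < i)
  calc ((-1 : ℂ)) ^ (A ∆ B).card = (-1) ^ (A ∆ B).card * ((-1) ^ 2) ^ (A ∩ B).card := by norm_num
    _ = (-1) ^ ((A ∆ B).card + 2 * (A ∩ B).card) := by rw [← pow_mul, ← pow_add]
    _ = (-1) ^ (A.card + B.card) := by rw [hcard]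

/-- `(s ∆ D) ∆ D = s`. [folklore] -/
theorem symmDiff_symmDiff_self' (s D : Finset ι) : (s ∆ D) ∆ D = s :=
  symmDiff_symmDiff_cancel_right D s

/-- For `i ∉ D`: `i ∈ s ∆ D ↔ i ∈ s`. [folklore] -/
theorem mem_symmDiff_of_not_mem_right {i : ι} {D : Finset ι} (hi : i ∉ D) (s : Finset ι) :
    i ∈ s ∆ D ↔ i ∈ s := by
  rw [Finset.mem_symmDiff]; tauto

/-- For `i ∈ D`: `i ∈ s ∆ D ↔ i ∉ s`. [folklore] -/
theorem mem_symmDiff_of_mem_right {i : ι} {D : Finset ι} (hi : i ∈ D) (s : Finset ι) :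
    i ∈ s ∆ D ↔ i ∉ s := by
  rw [Finset.mem_symmDiff]; tauto

/-- For `i ∉ D`: `insert i (s ∆ D) = (insert i s) ∆ D`. [folklore] -/
theorem insert_symmDiff_of_not_mem {i : ι} {D : Finset ι} (hi : i ∉ D) (s : Finset ι) :
    insert i (s ∆ D) = (insert i s) ∆ D := by
  ext x
  simp only [Finset.mem_insert, Finset.mem_symmDiff]
  by_cases hx : x = i
  · subst hx; tauto
  · tauto

/-- For `i ∈ D` and `i ∈ s`: `insert i (s ∆ D) = (s.erase i) ∆ D`. [folklore] -/
theorem insert_symmDiff_of_mem {i : ι} {D s : Finset ι} (hi : i ∈ D) (his : i ∈ s) :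
    insert i (s ∆ D) = (s.erase i) ∆ D := by
  ext x
  simp only [Finset.mem_insert, Finset.mem_symmDiff, Finset.mem_erase]
  by_cases hx : x = i
  · subst hx; tauto
  · tauto

/-! ### The transformation -/

/-- **The partial particle–hole transformation** on the orbitals `D`:
`W |s⟩ = w_D(s) |s ∆ D⟩`, `w_D(s) = ∏_{j ∈ s} (-1)^{#{l ∈ D | l < j}}`; as a matrix,
`W_{t,s} = [t = s ∆ D] · w_D(s)`. For `D` = the down-spin orbitals this is Lieb's
`c_{x↓} ↦ c†_{x↓}` (see `partialParticleHole_conj_annihilation_of_mem`).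
[cite: Lieb1989, proof of Theorem 2; BachLiebSolovej1994, §2] -/
def partialParticleHole (D : Finset ι) : Matrix (Finset ι) (Finset ι) ℂ :=
  fun t s => if t = s ∆ D then phWeight D s else 0

/-- Matrix entries (definitional unfolding). [folklore] -/
theorem partialParticleHole_apply (D t s : Finset ι) :
    partialParticleHole D t s = if t = s ∆ D then phWeight D s else 0 := rfl

variable [Fintype ι]

/-- The action on Fock vectors: `(W ψ)(t) = w_D(t ∆ D) ψ(t ∆ D)`. [folklore] -/
theorem partialParticleHole_mulVec_apply (D : Finset ι) (ψ : Fock ι) (t : Finset ι) :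
    (partialParticleHole D *ᵥ ψ) t = phWeight D (t ∆ D) * ψ (t ∆ D) := by
  have h : ∀ s, partialParticleHole D t s * ψ s =
      if t ∆ D = s then phWeight D (t ∆ D) * ψ (t ∆ D) else 0 := by
    intro s
    rw [partialParticleHole_apply]
    by_cases hs : t ∆ D = s
    · subst hs
      rw [if_pos (symmDiff_symmDiff_self' t D).symm, if_pos rfl]
    · rw [if_neg hs, if_neg, zero_mul]
      intro hts
      exact hs (by rw [hts, symmDiff_symmDiff_self'])
  simp only [mulVec, dotProduct, h, Finset.sum_ite_eq, Finset.mem_univ, if_true]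

/-- The action of the adjoint: `(Wᴴ ψ)(t) = w_D(t) ψ(t ∆ D)`. [folklore] -/
theorem partialParticleHole_conjTranspose_mulVec_apply (D : Finset ι) (ψ : Fock ι) (t : Finset ι) :
    ((partialParticleHole D)ᴴ *ᵥ ψ) t = phWeight D t * ψ (t ∆ D) := by
  have h : ∀ s, (partialParticleHole D)ᴴ t s * ψ s =
      if t ∆ D = s then phWeight D t * ψ (t ∆ D) else 0 := by
    intro s
    rw [conjTranspose_apply, partialParticleHole_apply]
    by_cases hs : t ∆ D = s
    · subst hs
      rw [if_pos rfl, if_pos rfl, star_phWeight]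
    · rw [if_neg (fun h => hs h.symm), if_neg hs, star_zero, zero_mul]
  simp only [mulVec, dotProduct, h, Finset.sum_ite_eq, Finset.mem_univ, if_true]

/-- `W Wᴴ = 1`. [folklore] -/
theorem partialParticleHole_mul_conjTranspose (D : Finset ι) :
    partialParticleHole D * (partialParticleHole D)ᴴ = 1 := by
  apply matrix_eq_of_mulVec_eq
  intro ψ
  funext t
  rw [← mulVec_mulVec, partialParticleHole_mulVec_apply,
    partialParticleHole_conjTranspose_mulVec_apply, symmDiff_symmDiff_self', one_mulVec, ← mul_assoc,
    phWeight_mul_self, one_mul]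

/-- `Wᴴ W = 1`. [folklore] -/
theorem partialParticleHole_conjTranspose_mul (D : Finset ι) :
    (partialParticleHole D)ᴴ * partialParticleHole D = 1 := by
  apply matrix_eq_of_mulVec_eq
  intro ψ
  funext t
  rw [← mulVec_mulVec, partialParticleHole_conjTranspose_mulVec_apply,
    partialParticleHole_mulVec_apply, symmDiff_symmDiff_self', one_mulVec, ← mul_assoc,
    phWeight_mul_self, one_mul]

/-- The partial particle–hole transformation is unitary. [cite: BachLiebSolovej1994, §2] -/
theorem partialParticleHole_mem_unitaryGroup (D : Finset ι) :
    partialParticleHole D ∈ Matrix.unitaryGroup (Finset ι) ℂ := by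
  rw [Matrix.mem_unitaryGroup_iff, star_eq_conjTranspose]
  exact partialParticleHole_mul_conjTranspose D

/-- **Orbitals outside `D` are untouched**: `W c_i Wᴴ = c_i` for `i ∉ D` (no residual sign).
[cite: Lieb1989, proof of Theorem 2] -/
theorem partialParticleHole_conj_annihilation_of_not_mem {D : Finset ι} {i : ι} (hi : i ∉ D) :
    partialParticleHole D * annihilation i * (partialParticleHole D)ᴴ = annihilation i := by
  apply matrix_eq_of_mulVec_eq
  intro ψ
  funext t
  rw [← mulVec_mulVec, ← mulVec_mulVec, partialParticleHole_mulVec_apply, annihilation_mulVec_apply,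
    annihilation_mulVec_apply]
  by_cases hit : i ∈ t
  · have hit' : i ∈ t ∆ D := (mem_symmDiff_of_not_mem_right hi t).2 hit
    rw [if_neg (not_not_intro hit'), if_neg (not_not_intro hit), mul_zero]
  · have hit' : i ∉ t ∆ D := fun h => hit ((mem_symmDiff_of_not_mem_right hi t).1 h)
    rw [if_pos hit', if_pos hit, partialParticleHole_conjTranspose_mulVec_apply,
      insert_symmDiff_of_not_mem hi, symmDiff_symmDiff_self', jwSign_symmDiff,
      ← insert_symmDiff_of_not_mem hi, phWeight_insert D hit']
    set w := phWeight D (t ∆ D)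
    calc w * (jwSign i t * jwSign i D * (jwSign i D * w * ψ (insert i t)))
        = (w * w) * (jwSign i D * jwSign i D) * (jwSign i t * ψ (insert i t)) := by ring
      _ = jwSign i t * ψ (insert i t) := by rw [phWeight_mul_self, jwSign_mul_self, one_mul, one_mul]

/-- **Particle–hole exchange on `D`**: `W c_i Wᴴ = c†_i` for `i ∈ D` (no residual sign).
[cite: Lieb1989, proof of Theorem 2; BachLiebSolovej1994, §2] -/
theorem partialParticleHole_conj_annihilation_of_mem {D : Finset ι} {i : ι} (hi : i ∈ D) :
    partialParticleHole D * annihilation i * (partialParticleHole D)ᴴ = creation i := by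
  apply matrix_eq_of_mulVec_eq
  intro ψ
  funext t
  rw [← mulVec_mulVec, ← mulVec_mulVec, partialParticleHole_mulVec_apply, annihilation_mulVec_apply,
    creation_mulVec_apply]
  by_cases hit : i ∈ t
  · have hit' : i ∉ t ∆ D := fun h => (mem_symmDiff_of_mem_right hi t).1 h hit
    rw [if_pos hit', if_pos hit, partialParticleHole_conjTranspose_mulVec_apply,
      insert_symmDiff_of_mem hi hit, symmDiff_symmDiff_self', jwSign_symmDiff, jwSign_erase_self]
    have hw : phWeight D (t ∆ D) = jwSign i D * phWeight D ((t.erase i) ∆ D) := by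
      rw [← insert_symmDiff_of_mem hi hit, phWeight_insert D hit', ← mul_assoc, jwSign_mul_self, one_mul]
    rw [hw]
    set w := phWeight D ((t.erase i) ∆ D)
    calc jwSign i D * w * (jwSign i t * jwSign i D * (w * ψ (t.erase i)))
        = (w * w) * (jwSign i D * jwSign i D) * (jwSign i t * ψ (t.erase i)) := by ring
      _ = jwSign i t * ψ (t.erase i) := by rw [phWeight_mul_self, jwSign_mul_self, one_mul, one_mul]
  · have hit' : i ∈ t ∆ D := (mem_symmDiff_of_mem_right hi t).2 hit
    rw [if_neg (not_not_intro hit'), if_neg hit, mul_zero]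

/-- `W c†_i Wᴴ = c†_i` for `i ∉ D`. [folklore] -/
theorem partialParticleHole_conj_creation_of_not_mem {D : Finset ι} {i : ι} (hi : i ∉ D) :
    partialParticleHole D * creation i * (partialParticleHole D)ᴴ = creation i := by
  have h := congrArg conjTranspose (partialParticleHole_conj_annihilation_of_not_mem (D := D) hi)
  rwa [conjTranspose_mul, conjTranspose_mul, conjTranspose_conjTranspose, annihilation_conjTranspose,
    ← mul_assoc] at h

/-- `W c†_i Wᴴ = c_i` for `i ∈ D`. [folklore] -/
theorem partialParticleHole_conj_creation_of_mem {D : Finset ι} {i : ι} (hi : i ∈ D) :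
    partialParticleHole D * creation i * (partialParticleHole D)ᴴ = annihilation i := by
  have h := congrArg conjTranspose (partialParticleHole_conj_annihilation_of_mem (D := D) hi)
  rwa [conjTranspose_mul, conjTranspose_mul, conjTranspose_conjTranspose, annihilation_conjTranspose,
    ← mul_assoc, creation_conjTranspose] at h

/-- Conjugation is multiplicative: `W (A B) Wᴴ = (W A Wᴴ)(W B Wᴴ)`. [folklore] -/
theorem partialParticleHole_conj_mul (D : Finset ι) (A B : Matrix (Finset ι) (Finset ι) ℂ) :
    partialParticleHole D * (A * B) * (partialParticleHole D)ᴴ =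
      (partialParticleHole D * A * (partialParticleHole D)ᴴ) *
        (partialParticleHole D * B * (partialParticleHole D)ᴴ) := by
  set W := partialParticleHole D
  calc W * (A * B) * Wᴴ = W * A * 1 * B * Wᴴ := by simp only [Matrix.mul_one, Matrix.mul_assoc]
    _ = W * A * (Wᴴ * W) * B * Wᴴ := by rw [partialParticleHole_conjTranspose_mul]
    _ = (W * A * Wᴴ) * (W * B * Wᴴ) := by simp only [Matrix.mul_assoc]

end Literature.MathematicalPhysics.QuantumLattice

end
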